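import Summits.QuantumFields.BalabanUV.T4Continuum.Support.NE7SliceIterationStateFacts
import Summits.QuantumFields.BalabanUV.T4Continuum.Support.BlockAverageCurrent
import HarnessLib

/-!
# NE7SliceIterationStep — ONE STEP OF THE (S1) ITERATION IN STATE FORM (memo ROAD-G100 §2.7 item F4, third file): for a state `u` on the working region (chart `U′^{u} = W e^{X(u)}`,
# corners `u(M•z) = e^{h(u)z}`, `‖X(u)‖ ≤ s ≤ 10⁻⁴`, `‖h(u)‖ ≤ η ≤ 10⁻²`, `6dM·Df(u) ≤ 10⁻⁴`) the next state `u¹ := e^{−ζ(u)}u` is unitary periodic, satisfies the chart and corner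
# conditions, `‖X(u¹)‖ ≤ s + δ + e_J`, `‖h(u¹)‖ ≤ η + σ + 4096ση`, moves each site by `≤ 2σ` (`δ ≥ ‖gaugeDir W ζ(u)‖`, `σ ≥ ‖ζ(u)‖`; `δ = Df(u)`, `σ = 6dM·Df(u)` do), AND ITS DEFECT IS
# THAT OF THE ERROR FIELD:
# `Df(u¹) ≤ (e_E + s_E) + (frameC·M·e_E + e_c)∕M` for any `e_E, c_E` above the error-field sizes (the curved sup letter (L) displayed as `hLet`)

Cell `pub-balaban`, rung (B)+1 sub-cell t4, lineage `b2b-balaban-t4-ne7-p1`, generation 101 (CRUX PROVER NE7 #1 = OWNER of BINDER row NE7).  Memo `t4/b2b-balaban-t4-ne7-p1-g101/ROAD-G101.md` §7.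
THIS FILE turns the displayed-object theorems (`NE7SliceStepIdentities`, `NE7SliceStepErrorSizes`, `NE7SliceStepOneStep.one_step_split_sized`, `NE7SliceSplitUnique.slice_split_unique`) into
statements about the state maps of `NE7SliceIterationState` (`repLog`, `cornerLog`, `coarseDatum`, `normalPart`, `tangentPart`, `gaugeFun`, `slicePart`, `frameMismatch`, `sliceDefect`, `sliceStep`),
using the working-region facts of `NE7SliceIterationStateFacts`.  The junk of the step: `J := X(u¹) − (X(u) − gaugeDir W ζ(u))`, `j_c := h(u¹) − (h(u) − ζ(u)(M•·))`.
WHAT ([folklore]; 0 def, 0 sorry).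
§1 `sliceStep_apply`, `norm_gaugeDir_le_sliceDefect` (`δ := Df(u)` does; `σ := 6dM·Df(u)` does by `NE7SliceIterationStateFacts.norm_gaugeFun_le`, `θ_P ≤ 1∕2`), `sliceStep_unitary`, `sliceStep_periodic`,
   **`sliceStep_chart`**, **`sliceStep_corner`**, `norm_bondJunk_le`, `norm_cornerJunk_le`, **`norm_repLog_sliceStep_le`**, **`norm_cornerLog_sliceStep_le`**, **`norm_sliceStep_sub_le`** (`≤ 2σ`).
§2 **`sliceDefect_sliceStep_le`** (statement displayed).
HONEST FRAMING (page 1): plumbing over landed theorems, (L) displayed as a hypothesis; nothing of Bałaban's asserted; NOT the contraction constant∕orbit (next file), NOT (S1), NOT NE7; spine 0∕9; finite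
T⁴ rung (B)+1 — NOT infinite volume, NOT mass gap, NOT BetaPertH, NOT Clay.  Continuum YM on T⁴ ⇐ BetaPertH ∧ nine spine estimates (0/9 proved); BetaPertH ⇐ (D1) ∧ (D4) ∧ CAP+tail; G-an2-4
gates asym, D1 and NE2/3/4.
-/

set_option autoImplicit false

open scoped BigOperators Matrix.Norms.L2Operator
open NormedSpace Finset

namespace Summit.QuantumFields.BalabanUV.T4Continuum.NE7SliceIterationStep

open Literature.MathematicalPhysics.QuantumFieldTheory.Balaban1983to89
open B7Prop1Explicit B7Prop2Explicit MatrixLog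
open T4AveragingDeficitWall (IsUnitaryCfg IsSkewDir SmallField vary curlAt)
open T4AveragingDeficitWallBoundary (IsPeriodicCfg periodBox)
open AveragingDeficitPeriodicCounting (IsPeriodicDir)
open AveragingDeficitTwoLevelPrep (prop1Radius)
open AveragingDeficitMultiLevelPrep (cavgIter LevelSmall tower cavgIter_unitary_small)
open BlockAveragePushDirGauge (gaugeDir isPeriodicDir_gaugeDir)
open BlockAverageLogInteraction (norm_exp_sub_one_le_two_mul)
open BlockAverageCurrent (smallField_gaugeAct)
open NE3EnergyShapes (IsUnitarySite IsPeriodicSite)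
open NE3TangentCovariantTower (dirIter framePotW)
open NE3CovariantBlockMean (bmeanIterW)
open NE3RightInverseSupLetters (frameC supC)
open NE3HatInvCurlLetters (supCurlC)
open NE3QbarIterCovLiftPrep (cruxC)
open NE3SmoothRightInverseW (rightInvW)
open NE3FramePotBoundW (tower_eq_pow_mul)
open NE3LandauOrbit (gaugeDir_skew)
open NE3LinearisedAverageSup (curvSum)
open NE7MeanZeroGaugeSliceW (energyBlockLandauW)
open NE7SliceSplitUnique (slice_split_unique)
open NE7SliceStepIdentities (step_rep exp_corner_succ phi_sub_phi_succ tangent_succ datum_succ)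
open NE7SliceStepErrorSizes (sup_step_residue_le sup_corner_residue_le sup_curl_step_residue_le)
open NE7SliceStepOneStep (one_step_split_sized)
open SpreadLift (loopRad)
open NE7SliceIterationState
open NE7SliceIterationStateFacts

noncomputable section

variable {d : ℕ} {n : Type*} [Fintype n] [DecidableEq n]

section Step

variable [Nonempty n] {L : ℕ} (hL : 2 ≤ L) (k : ℕ) {W : Site d → Fin d → (Matrix n n ℂ)ˣ} {x : ℝ} (hWu : IsUnitaryCfg W) (hx : 0 ≤ x) (hs : LevelSmall d L k x)
  (hWx : SmallField W x) (N : ℕ) [NeZero N] (hθ : cruxC d L * (((L : ℝ) ^ (k + 1)) ^ 2 * x) < 1) (U' : Site d → Fin d → (Matrix n n ℂ)ˣ)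
  (hWP : IsPeriodicCfg W ((tower L N (k + 1) : ℕ) : ℤ)) (hU'u : IsUnitaryCfg U') (hU'P : IsPeriodicCfg U' ((tower L N (k + 1) : ℕ) : ℤ))
  {u : Site d → (Matrix n n ℂ)ˣ} (hu : IsUnitarySite u) (huP : IsPeriodicSite u ((tower L N (k + 1) : ℕ) : ℤ))
  (hgauge : gaugeAct u U' = vary W (repLog W U' u) 1)
  (hcorner : ∀ z, ((u (((L : ℤ) ^ (k + 1)) • z) : (Matrix n n ℂ)ˣ) : Matrix n n ℂ) = exp (cornerLog L k u z))
  {s η : ℝ} (hXs : ∀ y κ, ‖repLog W U' u y κ‖ ≤ s) (hs4 : s ≤ 1 / 10000) (hhs : ∀ z, ‖cornerLog L k u z‖ ≤ η) (hη2 : η ≤ 1 / 100)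
  {δ σ : ℝ} (hδ : ∀ y μ, ‖gaugeDir W (gaugeFun hL k hWu hx hs hWx N hθ U' u) y μ‖ ≤ δ) (hσ : ∀ y, ‖gaugeFun hL k hWu hx hs hWx N hθ U' u y‖ ≤ σ)
  (hσ4 : σ ≤ 1 / 10000)

/-! ## §1 The next state: unitary, periodic, chart, corners, sizes, displacement -/

/-- `(e^{−ζ(u)}u)(y) = e^{−ζ(u)(y)}·u(y)`. [folklore] -/
theorem sliceStep_apply (u : Site d → (Matrix n n ℂ)ˣ) (y : Site d) :
    sliceStep hL k hWu hx hs hWx N hθ U' u y = expUnit (-gaugeFun hL k hWu hx hs hWx N hθ U' u y) * u y := rfl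

omit [Nonempty n] [NeZero N] in
include hXs hs4 in
/-- size bookkeeping: `‖X(u)‖ ≤ 1∕8`. [folklore] -/
theorem norm_repLog_le_eighth (y : Site d) (κ : Fin d) : ‖repLog W U' u y κ‖ ≤ 1 / 8 := (hXs y κ).trans (by linarith)

omit [Nonempty n] [NeZero N] in
include hhs hη2 in
/-- size bookkeeping: `‖h(u)‖ ≤ 1∕8`. [folklore] -/
theorem norm_cornerLog_le_eighth (z : Site d) : ‖cornerLog L k u z‖ ≤ 1 / 8 := (hhs z).trans (by linarith)

include hWP hU'u hU'P hu huP hgauge hcorner hXs hs4 hhs hη2 in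
/-- **`‖gaugeDir W ζ(u)‖ ≤ Df(u)`** everywhere on the working region. [folklore] -/
theorem norm_gaugeDir_le_sliceDefect (y : Site d) (μ : Fin d) :
    ‖gaugeDir W (gaugeFun hL k hWu hx hs hWx N hθ U' u) y μ‖ ≤ sliceDefect hL k hWu hx hs hWx N hθ U' u :=
  (norm_gaugeDir_gaugeFun_le hL k hWu hx hs hWx N hθ U' hWP hU'u hU'P hu huP hgauge (norm_repLog_le_eighth U' hXs hs4) hcorner
    (norm_cornerLog_le_eighth k hhs hη2) y μ).trans (delta_le_sliceDefect hL k hWu hx hs hWx N hθ U' u)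

include hWP hU'u hU'P hu huP hgauge hcorner hXs hs4 hhs hη2 in
/-- **`u¹` IS UNITARY** (`ζ(u)` is skew). [folklore] -/
theorem sliceStep_unitary : IsUnitarySite (sliceStep hL k hWu hx hs hWx N hθ U' u) := by
  have hζs := (split_holds hL k hWu hx hs hWx N hθ U' hWP hU'u hU'P hu huP hgauge (norm_repLog_le_eighth U' hXs hs4) hcorner (norm_cornerLog_le_eighth k hhs hη2)).1
  intro y
  rw [sliceStep_apply]
  refine (unitaryUnits _).mul_mem ?_ (hu y)
  rw [mem_unitaryUnits, val_expUnit]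
  letI : NormedAlgebra ℚ (Matrix n n ℂ) := NormedAlgebra.restrictScalars ℚ ℂ (Matrix n n ℂ)
  exact NormedSpace.exp_mem_unitary_of_mem_skewAdjoint ((skewAdjoint _).neg_mem (hζs y))

include hWP hU'u hU'P hu huP hgauge hcorner hXs hs4 hhs hη2 in
/-- **`u¹` IS `(tower)`-PERIODIC**. [folklore] -/
theorem sliceStep_periodic : IsPeriodicSite (sliceStep hL k hWu hx hs hWx N hθ U' u) ((tower L N (k + 1) : ℕ) : ℤ) := by
  have hζP := (split_holds hL k hWu hx hs hWx N hθ U' hWP hU'u hU'P hu huP hgauge (norm_repLog_le_eighth U' hXs hs4) hcorner (norm_cornerLog_le_eighth k hhs hη2)).2.1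
  intro y i
  rw [sliceStep_apply, sliceStep_apply, hζP y i, huP y i]

include hgauge hXs hs4 hσ hσ4 in
/-- **THE CHART CONDITION PROPAGATES**: `U′^{u¹} = W·e^{X(u¹)}`. [folklore] -/
theorem sliceStep_chart : gaugeAct (sliceStep hL k hWu hx hs hWx N hθ U' u) U' = vary W (repLog W U' (sliceStep hL k hWu hx hs hWx N hθ U' u)) 1 :=
  step_rep hWu hgauge (fun y => (hσ y).trans hσ4) (fun y κ => (hXs y κ).trans hs4)

include hcorner hhs hη2 hσ hσ4 in
/-- **THE CORNER CONDITION PROPAGATES**: `u¹(M•z) = e^{h(u¹) z}`. [folklore] -/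
theorem sliceStep_corner (z : Site d) :
    ((sliceStep hL k hWu hx hs hWx N hθ U' u (((L : ℤ) ^ (k + 1)) • z) : (Matrix n n ℂ)ˣ) : Matrix n n ℂ)
      = exp (cornerLog L k (sliceStep hL k hWu hx hs hWx N hθ U' u) z) :=
  (exp_corner_succ (hcorner z) ((hσ _).trans (hσ4.trans (by norm_num))) ((hhs z).trans hη2)).symm

include hgauge hXs hs4 hδ hσ hσ4 in
/-- **THE BOND JUNK** `J := X(u¹) − (X(u) − gaugeDir W ζ(u))`: `‖J‖ ≤ e_J := 16384·δ·s + 2048·σ·δ + 6σs`. [folklore] -/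
theorem norm_bondJunk_le (y : Site d) (κ : Fin d) :
    ‖repLog W U' (sliceStep hL k hWu hx hs hWx N hθ U' u) y κ - (repLog W U' u y κ - gaugeDir W (gaugeFun hL k hWu hx hs hWx N hθ U' u) y κ)‖
      ≤ 16384 * δ * s + 2048 * σ * δ + 6 * σ * s :=
  sup_step_residue_le hWu hgauge (u := u) hσ hσ4 hXs hs4 hδ y κ

include hcorner hhs hη2 hσ hσ4 in
/-- **THE CORNER JUNK** `j_c := h(u¹) − (h(u) − ζ(u)(M•·))`: `‖j_c‖ ≤ e_c := 4096·σ·η`. [folklore] -/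
theorem norm_cornerJunk_le (z : Site d) :
    ‖cornerLog L k (sliceStep hL k hWu hx hs hWx N hθ U' u) z - (cornerLog L k u z - gaugeFun hL k hWu hx hs hWx N hθ U' u (((L : ℤ) ^ (k + 1)) • z))‖
      ≤ 4096 * σ * η :=
  sup_corner_residue_le (hcorner z) (hσ (((L : ℤ) ^ (k + 1)) • z)) (hσ4.trans (by norm_num)) (hhs z) hη2

include hgauge hXs hs4 hδ hσ hσ4 in
/-- **THE SIZE OF `X(u¹)`**: `‖X(u¹)‖ ≤ s + δ + e_J`. [folklore] -/
theorem norm_repLog_sliceStep_le (y : Site d) (κ : Fin d) :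
    ‖repLog W U' (sliceStep hL k hWu hx hs hWx N hθ U' u) y κ‖ ≤ s + δ + (16384 * δ * s + 2048 * σ * δ + 6 * σ * s) := by
  have hJ := norm_bondJunk_le hL k hWu hx hs hWx N hθ U' hgauge hXs hs4 hδ hσ hσ4 y κ
  have e : repLog W U' (sliceStep hL k hWu hx hs hWx N hθ U' u) y κ
      = (repLog W U' (sliceStep hL k hWu hx hs hWx N hθ U' u) y κ - (repLog W U' u y κ - gaugeDir W (gaugeFun hL k hWu hx hs hWx N hθ U' u) y κ))
        + (repLog W U' u y κ - gaugeDir W (gaugeFun hL k hWu hx hs hWx N hθ U' u) y κ) := by abel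
  rw [e]
  refine (norm_add_le _ _).trans ?_
  have h2 := norm_sub_le (repLog W U' u y κ) (gaugeDir W (gaugeFun hL k hWu hx hs hWx N hθ U' u) y κ)
  linarith only [hJ, h2, hXs y κ, hδ y κ]

include hcorner hhs hη2 hσ hσ4 in
/-- **THE SIZE OF `h(u¹)`**: `‖h(u¹) z‖ ≤ η + σ + 4096·σ·η`. [folklore] -/
theorem norm_cornerLog_sliceStep_le (z : Site d) :
    ‖cornerLog L k (sliceStep hL k hWu hx hs hWx N hθ U' u) z‖ ≤ η + σ + 4096 * σ * η := by
  have hjc := norm_cornerJunk_le hL k hWu hx hs hWx N hθ U' hcorner hhs hη2 hσ hσ4 z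
  have e : cornerLog L k (sliceStep hL k hWu hx hs hWx N hθ U' u) z
      = (cornerLog L k (sliceStep hL k hWu hx hs hWx N hθ U' u) z - (cornerLog L k u z - gaugeFun hL k hWu hx hs hWx N hθ U' u (((L : ℤ) ^ (k + 1)) • z)))
        + (cornerLog L k u z - gaugeFun hL k hWu hx hs hWx N hθ U' u (((L : ℤ) ^ (k + 1)) • z)) := by abel
  rw [e]
  refine (norm_add_le _ _).trans ?_
  have h2 := norm_sub_le (cornerLog L k u z) (gaugeFun hL k hWu hx hs hWx N hθ U' u (((L : ℤ) ^ (k + 1)) • z))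
  linarith only [hjc, h2, hhs z, hσ (((L : ℤ) ^ (k + 1)) • z)]

include hu hσ hσ4 in
/-- **THE DISPLACEMENT**: `‖u¹(y) − u(y)‖ ≤ 2σ`. [folklore] -/
theorem norm_sliceStep_sub_le (y : Site d) :
    ‖((sliceStep hL k hWu hx hs hWx N hθ U' u y : (Matrix n n ℂ)ˣ) : Matrix n n ℂ) - ((u y : (Matrix n n ℂ)ˣ) : Matrix n n ℂ)‖ ≤ 2 * σ := by
  have hσ := hσ y
  have hu1 : ‖((u y : (Matrix n n ℂ)ˣ) : Matrix n n ℂ)‖ = 1 := CStarRing.norm_of_mem_unitary (mem_unitaryUnits.mp (hu y))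
  have e : ((sliceStep hL k hWu hx hs hWx N hθ U' u y : (Matrix n n ℂ)ˣ) : Matrix n n ℂ) - ((u y : (Matrix n n ℂ)ˣ) : Matrix n n ℂ)
      = (exp (-gaugeFun hL k hWu hx hs hWx N hθ U' u y) - 1) * ((u y : (Matrix n n ℂ)ˣ) : Matrix n n ℂ) := by
    rw [sliceStep_apply, Units.val_mul, val_expUnit, sub_mul, one_mul]
  rw [e]
  refine (norm_mul_le _ _).trans ?_
  rw [hu1, mul_one]
  exact (norm_exp_sub_one_le_two_mul (by rw [norm_neg]; exact hσ) (hσ4.trans (by norm_num))).1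

/-! ## §2 The defect after the step -/

include hWP hU'u hU'P hu huP hgauge hcorner hXs hs4 hhs hη2 hδ hσ hσ4 in
/-- **THE DEFECT AFTER ONE STEP** (multi-level small-field class at level `k+1`, `d ≥ 1`, `L ≥ 2`, `W`, `U′` unitary `(tower)`-periodic, `SmallField W x`, `SmallField U′ x′`, Poincaré parameter
`θ_P ≤ 1∕2`, `cruxC·M²x < 1`, `M²x ≤ 1`, `curvSum ≤ 2L∕3`, the curved sup letter (L) with constant `K ≥ 0` displayed as `hLet`, absorption `16Kd·M²x ≤ 1∕2`; state `u` on the working region with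
`‖X(u)‖ ≤ s ≤ 10⁻⁴`, `‖h(u)‖ ≤ η ≤ 10⁻²`, `‖gaugeDir W ζ(u)‖ ≤ δ ≤ 10⁻⁴`, `‖ζ(u)‖ ≤ σ ≤ 10⁻⁴`): with `e_J := 16384δs + 2048σδ + 6σs`, `e_c := 4096ση`,
`c_J := 2(2σ)x′ + 4(e^{4(s+δ+e_J)} − 1)(δ + e_J) + 2xσ`, `e_φ := (3+12d)M·e_J + 2e_c`, and ANY `e_E ≥ e_J + supC∕(M(1−cruxC·M²x))·e_φ`, `c_E ≥ c_J + supCurlC∕(M²(1−cruxC·M²x))·e_φ`: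
`Df(e^{−ζ(u)}u) ≤ (e_E + s_E) + (frameC·M·e_E + e_c)∕M`, `s_E := 2KM·c_E + 8K(M²x)(frameC·M·e_E + e_c)∕M + 16Kd(M²x)·e_E`. [folklore] -/
theorem sliceDefect_sliceStep_le (hd : 0 < d)
    (hθP : 4 * (d : ℝ) ^ 2 * ((L : ℝ) ^ (k + 1) - 1) ^ 2 * x + 16 * d * loopRad d L ((prop1Radius d L)^[k] x)
      + 4 * d * ((d : ℝ) - 1) * ((L : ℝ) ^ (k + 1) - 1) ^ 2 * x ≤ 1 / 2)
    {K : ℝ} (hK : 0 ≤ K) (hKε : 16 * K * d * (((L : ℝ) ^ (k + 1)) ^ 2 * x) ≤ 1 / 2)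
    (hLet : ∀ Y : Site d → Fin d → Matrix n n ℂ, Y ∈ energyBlockLandauW (d := d) (n := n) L N (k + 1) W →
      ∀ B : ℝ, (∀ (z : Site d) (μ ν : Fin d), μ ≠ ν → ‖curlAt W Y z μ ν‖ ≤ B) → ∀ (y : Site d) (κ : Fin d), ‖Y y κ‖ ≤ K * (L : ℝ) ^ (k + 1) * B)
    (hε : ((L : ℝ) ^ (k + 1)) ^ 2 * x ≤ 1) (hA : curvSum d L (k + 1) x ≤ 2 / 3 * L) {x' : ℝ} (hU'x : SmallField U' x')
    (hs0 : 0 ≤ s) (hη0 : 0 ≤ η) (hδ0 : 0 ≤ δ) (hδ4 : δ ≤ 1 / 10000) (hσ0 : 0 ≤ σ)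
    {eE cE : ℝ} (heE0 : 0 ≤ eE) (hcE0 : 0 ≤ cE)
    (heE : (16384 * δ * s + 2048 * σ * δ + 6 * σ * s)
      + supC d L / ((L : ℝ) ^ (k + 1) * (1 - cruxC d L * (((L : ℝ) ^ (k + 1)) ^ 2 * x)))
        * ((3 + 12 * (d : ℝ)) * (L : ℝ) ^ (k + 1) * (16384 * δ * s + 2048 * σ * δ + 6 * σ * s) + 2 * (4096 * σ * η)) ≤ eE)
    (hcE : (2 * (2 * σ) * x' + 4 * (Real.exp (4 * (s + δ + (16384 * δ * s + 2048 * σ * δ + 6 * σ * s))) - 1) * (δ + (16384 * δ * s + 2048 * σ * δ + 6 * σ * s)) + 2 * x * σ)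
      + supCurlC d L / (((L : ℝ) ^ (k + 1)) ^ 2 * (1 - cruxC d L * (((L : ℝ) ^ (k + 1)) ^ 2 * x)))
        * ((3 + 12 * (d : ℝ)) * (L : ℝ) ^ (k + 1) * (16384 * δ * s + 2048 * σ * δ + 6 * σ * s) + 2 * (4096 * σ * η)) ≤ cE) :
    sliceDefect hL k hWu hx hs hWx N hθ U' (sliceStep hL k hWu hx hs hWx N hθ U' u)
      ≤ (eE + (2 * K * (L : ℝ) ^ (k + 1) * cE + 8 * K * (((L : ℝ) ^ (k + 1)) ^ 2 * x) * (frameC d L * (L : ℝ) ^ (k + 1) * eE + 4096 * σ * η) / (L : ℝ) ^ (k + 1)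
          + 16 * K * d * (((L : ℝ) ^ (k + 1)) ^ 2 * x) * eE))
        + (frameC d L * (L : ℝ) ^ (k + 1) * eE + 4096 * σ * η) / (L : ℝ) ^ (k + 1) := by
  haveI : NeZero L := ⟨by omega⟩
  have hL1 : 1 ≤ L := by omega
  have hM : 0 < (L : ℝ) ^ (k + 1) := pow_pos (by exact_mod_cast (by omega : 0 < L)) _
  have hP1 : 1 ≤ tower L N (k + 1) := Nat.one_le_iff_ne_zero.mpr (NeZero.ne _)
  have hN1 : 1 ≤ N := Nat.one_le_iff_ne_zero.mpr (NeZero.ne _)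
  have heJ0 : 0 ≤ 16384 * δ * s + 2048 * σ * δ + 6 * σ * s := by positivity
  have hec0 : 0 ≤ 4096 * σ * η := by positivity
  -- state-0 facts
  have hX8 := norm_repLog_le_eighth U' hXs hs4
  have hh8 := norm_cornerLog_le_eighth k hhs hη2
  obtain ⟨hζs, hζP, hY0, hsplit0, hmean0⟩ := split_holds hL k hWu hx hs hWx N hθ U' hWP hU'u hU'P hu huP hgauge hX8 hcorner hh8
  have hφ0 := coarseDatum_skew_periodic hL k hWu hx hs hWx N U' hWP hU'u hU'P hu huP hgauge hX8 hcorner hh8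
  -- the next state, made opaque, and its facts
  obtain ⟨u1, hu1def⟩ : ∃ v : Site d → (Matrix n n ℂ)ˣ, v = sliceStep hL k hWu hx hs hWx N hθ U' u := ⟨_, rfl⟩
  rw [← hu1def]
  have hu1 : IsUnitarySite u1 := by
    rw [hu1def]; exact sliceStep_unitary hL k hWu hx hs hWx N hθ U' hWP hU'u hU'P hu huP hgauge hcorner hXs hs4 hhs hη2
  have hu1P : IsPeriodicSite u1 ((tower L N (k + 1) : ℕ) : ℤ) := by
    rw [hu1def]; exact sliceStep_periodic hL k hWu hx hs hWx N hθ U' hWP hU'u hU'P hu huP hgauge hcorner hXs hs4 hhs hη2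
  have hgauge1 : gaugeAct u1 U' = vary W (repLog W U' u1) 1 := by
    rw [hu1def]; exact sliceStep_chart hL k hWu hx hs hWx N hθ U' hgauge hXs hs4 hσ hσ4
  have hcorner1 : ∀ z, ((u1 (((L : ℤ) ^ (k + 1)) • z) : (Matrix n n ℂ)ˣ) : Matrix n n ℂ) = exp (cornerLog L k u1 z) := by
    rw [hu1def]; exact sliceStep_corner hL k hWu hx hs hWx N hθ U' hcorner hhs hη2 hσ hσ4
  have hJraw : ∀ y κ, ‖repLog W U' u1 y κ - (repLog W U' u y κ - gaugeDir W (gaugeFun hL k hWu hx hs hWx N hθ U' u) y κ)‖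
      ≤ 16384 * δ * s + 2048 * σ * δ + 6 * σ * s := by
    rw [hu1def]; exact norm_bondJunk_le hL k hWu hx hs hWx N hθ U' hgauge hXs hs4 hδ hσ hσ4
  have hjcraw : ∀ z, ‖cornerLog L k u1 z - (cornerLog L k u z - gaugeFun hL k hWu hx hs hWx N hθ U' u (((L : ℤ) ^ (k + 1)) • z))‖ ≤ 4096 * σ * η := by
    rw [hu1def]; exact norm_cornerJunk_le hL k hWu hx hs hWx N hθ U' hcorner hhs hη2 hσ hσ4
  have hX1 : ∀ y κ, ‖repLog W U' u1 y κ‖ ≤ s + δ + (16384 * δ * s + 2048 * σ * δ + 6 * σ * s) := by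
    rw [hu1def]; exact norm_repLog_sliceStep_le hL k hWu hx hs hWx N hθ U' hgauge hXs hs4 hδ hσ hσ4
  have hh1 : ∀ z, ‖cornerLog L k u1 z‖ ≤ η + σ + 4096 * σ * η := by
    rw [hu1def]; exact norm_cornerLog_sliceStep_le hL k hWu hx hs hWx N hθ U' hcorner hhs hη2 hσ hσ4
  have heJs : 16384 * δ * s + 2048 * σ * δ + 6 * σ * s ≤ 3 / 10000 := by
    nlinarith [mul_nonneg hδ0 hs0, mul_nonneg hσ0 hδ0, mul_nonneg hσ0 hs0, mul_le_mul hδ4 hs4 hs0 (by norm_num : (0:ℝ) ≤ 1 / 10000),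
      mul_le_mul hσ4 hδ4 hδ0 (by norm_num : (0:ℝ) ≤ 1 / 10000), mul_le_mul hσ4 hs4 hs0 (by norm_num : (0:ℝ) ≤ 1 / 10000)]
  have hX1_8 : ∀ y κ, ‖repLog W U' u1 y κ‖ ≤ 1 / 8 := fun y κ => (hX1 y κ).trans (by linarith)
  have hecs : 4096 * σ * η ≤ 1 / 200 := by nlinarith [mul_le_mul hσ4 hη2 hη0 (by norm_num : (0:ℝ) ≤ 1 / 10000)]
  have hσ1 : σ ≤ 1 / 10000 := hσ4
  have hh1_8 : ∀ z, ‖cornerLog L k u1 z‖ ≤ 1 / 8 := fun z => (hh1 z).trans (by linarith)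
  have hφ1 := coarseDatum_skew_periodic hL k hWu hx hs hWx N U' hWP hU'u hU'P hu1 hu1P hgauge1 hX1_8 hcorner1 hh1_8
  obtain ⟨hζ1s, hζ1P, hY1, hsplit1, hmean1⟩ := split_holds hL k hWu hx hs hWx N hθ U' hWP hU'u hU'P hu1 hu1P hgauge1 hX1_8 hcorner1 hh1_8
  -- the junk fields
  obtain ⟨J, hJdef⟩ : ∃ J : Site d → Fin d → Matrix n n ℂ, J = fun y κ =>
      repLog W U' u1 y κ - (repLog W U' u y κ - gaugeDir W (gaugeFun hL k hWu hx hs hWx N hθ U' u) y κ) := ⟨_, rfl⟩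
  obtain ⟨jc, hjcdef⟩ : ∃ jc : Site d → Matrix n n ℂ, jc = fun z =>
      cornerLog L k u1 z - (cornerLog L k u z - gaugeFun hL k hWu hx hs hWx N hθ U' u (((L : ℤ) ^ (k + 1)) • z)) := ⟨_, rfl⟩
  have hX1eq : ∀ y κ, repLog W U' u1 y κ = repLog W U' u y κ - gaugeDir W (gaugeFun hL k hWu hx hs hWx N hθ U' u) y κ + J y κ := fun y κ => by
    rw [hJdef, add_sub_cancel]
  have hh1eq : ∀ z, cornerLog L k u1 z = cornerLog L k u z - gaugeFun hL k hWu hx hs hWx N hθ U' u (((L : ℤ) ^ (k + 1)) • z) + jc z := fun z => by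
    rw [hjcdef, add_sub_cancel]
  -- the coarse datum moves by the junk; the datum of the next split is the corner junk
  have hdφ : ∀ z κ, coarseDatum L k W U' u z κ - coarseDatum L k W U' u1 z κ = -dirIter L (k + 1) W J z κ + gaugeDir (cavgIter L (k + 1) W) jc z κ :=
    fun z κ => phi_sub_phi_succ hL1 k hWu hWP hx hs hWx hζs hζP hX1eq hh1eq z κ
  have hdat : ∀ z, cornerLog L k u1 z - framePotW L (k + 1) W (slicePart hL k hWu hx hs hWx N hθ U' u) z = jc z :=
    fun z => datum_succ hL1 k hWu hWP hx hs hWx hζs hζP hsplit0 hmean0 hh1eq z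
  -- skewness, periodicity and sizes of the junk
  have hX0s := repLog_skew hWu U' hU'u hu hgauge hX8
  have hX1s := repLog_skew hWu U' hU'u hu1 hgauge1 hX1_8
  have hgDs := gaugeDir_skew hWu hζs
  have hJs : IsSkewDir J := fun y κ => by
    rw [hJdef]; exact (skewAdjoint _).sub_mem (hX1s y κ) ((skewAdjoint _).sub_mem (hX0s y κ) (hgDs y κ))
  have hJP : IsPeriodicDir J ((tower L N (k + 1) : ℕ) : ℤ) := fun y i μ => by
    simp only [hJdef, repLog_periodic k N U' hWP hU'P huP y i μ, repLog_periodic k N U' hWP hU'P hu1P y i μ, isPeriodicDir_gaugeDir hWP hζP y i μ]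
  have hh0s := cornerLog_skew k hu hcorner hh8
  have hh1s := cornerLog_skew k hu1 hcorner1 hh1_8
  have hjcs : ∀ z, jc z ∈ skewAdjoint (Matrix n n ℂ) := fun z => by
    rw [hjcdef]; exact (skewAdjoint _).sub_mem (hh1s z) ((skewAdjoint _).sub_mem (hh0s z) (hζs _))
  have hT : ((tower L N (k + 1) : ℕ) : ℤ) = ((L : ℤ) ^ (k + 1)) * (N : ℤ) := by rw [tower_eq_pow_mul]; push_cast; ring
  have hjcP : ∀ (z : Site d) (i : Fin d), jc (z + (N : ℤ) • e i) = jc z := fun z i => by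
    have e1 : ((L : ℤ) ^ (k + 1)) • (z + (N : ℤ) • e i) = ((L : ℤ) ^ (k + 1)) • z + ((tower L N (k + 1) : ℕ) : ℤ) • e i := by
      rw [smul_add, smul_smul, hT]
    simp only [hjcdef, cornerLog_periodic k N huP z i, cornerLog_periodic k N hu1P z i, e1, hζP]
  have hJle : ∀ y κ, ‖J y κ‖ ≤ 16384 * δ * s + 2048 * σ * δ + 6 * σ * s := fun y κ => by rw [hJdef]; exact hJraw y κ
  have hjcle : ∀ z, ‖jc z‖ ≤ 4096 * σ * η := fun z => by rw [hjcdef]; exact hjcraw z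
  -- the curl of the bond junk (the relative plaquettes are conjugated by the step)
  have hx'0 : SmallField (vary W (repLog W U' u) 1) x' := hgauge ▸ smallField_gaugeAct hu hU'x
  have hρ0 : ∀ y κ, ‖repLog W U' u y κ‖ ≤ s + δ + (16384 * δ * s + 2048 * σ * δ + 6 * σ * s) := fun y κ => (hXs y κ).trans (by linarith)
  have hηJ : ∀ y κ, ‖repLog W U' u1 y κ - repLog W U' u y κ‖ ≤ δ + (16384 * δ * s + 2048 * σ * δ + 6 * σ * s) := by
    intro y κ
    have e : repLog W U' u1 y κ - repLog W U' u y κ = J y κ - gaugeDir W (gaugeFun hL k hWu hx hs hWx N hθ U' u) y κ := by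
      rw [hX1eq y κ]; abel
    rw [e]
    exact (norm_sub_le _ _).trans (by linarith only [hJle y κ, hδ y κ])
  have hcJ : ∀ (z : Site d) (μ ν : Fin d), μ ≠ ν → ‖curlAt W J z μ ν‖
      ≤ 2 * (2 * σ) * x' + 4 * (Real.exp (4 * (s + δ + (16384 * δ * s + 2048 * σ * δ + 6 * σ * s))) - 1) * (δ + (16384 * δ * s + 2048 * σ * δ + 6 * σ * s)) + 2 * x * σ := by
    rw [hJdef, hu1def]
    intro z μ ν hμν
    have hX1' : ∀ y κ, ‖repLog W U' (sliceStep hL k hWu hx hs hWx N hθ U' u) y κ‖ ≤ s + δ + (16384 * δ * s + 2048 * σ * δ + 6 * σ * s) := by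
      rw [← hu1def]; exact hX1
    have hηJ' : ∀ y κ, ‖repLog W U' (sliceStep hL k hWu hx hs hWx N hθ U' u) y κ - repLog W U' u y κ‖ ≤ δ + (16384 * δ * s + 2048 * σ * δ + 6 * σ * s) := by
      rw [← hu1def]; exact hηJ
    exact sup_curl_step_residue_le hWu hWx hgauge hx'0 hζs hσ hσ4 (fun y κ => (hXs y κ).trans hs4) hρ0 hX1' hηJ' z hμν
  -- the split of the next tangent part, sized
  obtain ⟨ζE, Yt1, hζEs, hζEP, hYt1, hsplitE, hmeanE, hmE, -, hδE, -⟩ :=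
    one_step_split_sized hL k hWu hWP hx hs hWx hθ hφ0.1 hφ1.1 hφ0.2 hφ1.2 hd hθP hK hKε hLet hε hA hY0 hJs hJP hjcs hjcP hdφ hdat
      heJ0 hec0 heE0 hcE0 hJle hcJ hjcle heE hcE
  -- `T(u¹) = Ỹ⁰ + (J + (Rφ⁰ − Rφ¹))`
  have hT1 : ∀ y μ, tangentPart hL k hWu hx hs hWx N hθ U' u1 y μ
      = slicePart hL k hWu hx hs hWx N hθ U' u y μ + (J y μ + (rightInvW hL k hWu hx hs hWx N hθ hφ0.1 y μ - rightInvW hL k hWu hx hs hWx N hθ hφ1.1 y μ)) := by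
    intro y μ
    have h0 := hsplit0 y μ
    simp only [tangentPart, normalPart_eq hL k hWu hx hs hWx N hθ U' hφ0.1] at h0
    simp only [tangentPart, normalPart_eq hL k hWu hx hs hWx N hθ U' hφ1.1]
    have e0 : repLog W U' u y μ = slicePart hL k hWu hx hs hWx N hθ U' u y μ + gaugeDir W (gaugeFun hL k hWu hx hs hWx N hθ U' u) y μ
        + rightInvW hL k hWu hx hs hWx N hθ hφ0.1 y μ := by rw [← h0]; abel
    rw [hX1eq y μ, e0]
    abel
  have hT1fun : (fun y μ => slicePart hL k hWu hx hs hWx N hθ U' u y μ + (J y μ + (rightInvW hL k hWu hx hs hWx N hθ hφ0.1 y μ - rightInvW hL k hWu hx hs hWx N hθ hφ1.1 y μ)))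
      = tangentPart hL k hWu hx hs hWx N hθ U' u1 := funext fun y => funext fun μ => (hT1 y μ).symm
  -- uniqueness of the normalised split: the chosen `ζ(u¹)` has the same `gaugeDir` as `ζ_E`
  have huniq := slice_split_unique k hWP (T := tangentPart hL k hWu hx hs hWx N hθ U' u1)
    hYt1 hY1 hζEs hζEP hζ1s hζ1P (fun y μ => (hT1 y μ).trans (hsplitE y μ)) hsplit1
    (funext fun z => by rw [hmeanE z, hmean1 z, hT1fun])
  have hgD1 : ∀ y μ, ‖gaugeDir W (gaugeFun hL k hWu hx hs hWx N hθ U' u1) y μ‖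
      ≤ eE + (2 * K * (L : ℝ) ^ (k + 1) * cE + 8 * K * (((L : ℝ) ^ (k + 1)) ^ 2 * x) * (frameC d L * (L : ℝ) ^ (k + 1) * eE + 4096 * σ * η) / (L : ℝ) ^ (k + 1)
          + 16 * K * d * (((L : ℝ) ^ (k + 1)) ^ 2 * x) * eE) := fun y μ => by
    rw [← huniq.2 y μ]; exact hδE y μ
  have hm1 : ∀ z, ‖framePotW L (k + 1) W (tangentPart hL k hWu hx hs hWx N hθ U' u1) z - cornerLog L k u1 z‖
      ≤ frameC d L * (L : ℝ) ^ (k + 1) * eE + 4096 * σ * η := fun z => by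
    rw [← hT1fun]; exact hmE z
  -- read off the defect
  have hsE0 : 0 ≤ eE + (2 * K * (L : ℝ) ^ (k + 1) * cE + 8 * K * (((L : ℝ) ^ (k + 1)) ^ 2 * x) * (frameC d L * (L : ℝ) ^ (k + 1) * eE + 4096 * σ * η) / (L : ℝ) ^ (k + 1)
      + 16 * K * d * (((L : ℝ) ^ (k + 1)) ^ 2 * x) * eE) := by
    have hfC : 0 ≤ frameC d L := by unfold frameC; positivity
    positivity
  unfold sliceDefect frameMismatch
  exact add_le_add (bondSup_le hP1 hsE0 hgD1) (div_le_div_of_nonneg_right (siteSup_le hN1 hm1) hM.le)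

end Step

end

end Summit.QuantumFields.BalabanUV.T4Continuum.NE7SliceIterationStep
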